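import Summits.CriticalPhenomena.Ising3D.TaylorTable
import HarnessLib

/-!
# Region-layer BRIDGE lemmas: a region certificate on a SUPERSET box with an equal functional record gives the table's region hypotheses by name
(cell `pub-ising3x`, seat boot-1 gen 11; R17 (d) supplement (ζ) BOX IDENTITY)

HONEST FRAMING: lottery ticket; floor = tightest certified 3D Ising CFT bounds; no exact-solution
claim without a proof. Island framing: certified exclusion region at stated derivative order and
assumptions; not a determination of the 3D Ising critical exponents beyond that.

The literal-table region file sets (`taylorEvenRegion_of_splitΔLPS` / `oddCone_of_splitΔLPS`) conclude the even
region / the odd cone for THEIR OWN data record `d` (weights `d.cQ` as an if-chain, index lists, box, `E0`,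
`κ₀Q`, `ψQ`), possibly on a box ENCLOSING the table's box (the odd ΔLPS twin is run on the /2¹⁶ box that
contains the /2¹⁸ table box). The γ-box theorem shapes of a table (`boxExcluded_of_heads…` /
`boxExcluded_of_headCerts…`) want the hypotheses `hR : TaylorEvenRegion T.α T.box T.E₀` and `hC : T.OddCone`
BY NAME. The two lemmas below are the bridge: if the record's box contains the table's box, its index lists
are the table's, its weights agree with the table's ON the index list (a finite, decidable check — the two
weight functions need not be equal off the list), its majorant weights agree on `Lψ`, and `κ₀`, `E0` agree,
then the record's region statement implies the table's. Ingredients: `taylorCrossing_congr` (the functional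
depends on the weights only through their values on the index set) and monotonicity in the box. Elementary;
no kernel computation here — the per-box bridge FILE instantiates these with `decide` / `norm_num` / `rfl`.
-/

namespace Summit.CriticalPhenomena.Ising3D

open Set Finset
open Literature.MathematicalPhysics.QuantumFieldTheory.ConformalBootstrap3D

/-- **The Taylor crossing functional depends on the weights only through their values on the index set.** [folklore] -/
theorem taylorCrossing_congr (x₀ y₀ : ℝ) (s : Finset (ℕ × ℕ)) {w w' : Fin 5 → ℕ × ℕ → ℝ}
    (h : ∀ i : Fin 5, ∀ p ∈ s, w i p = w' i p) :
    taylorCrossing x₀ y₀ s w = taylorCrossing x₀ y₀ s w' := by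
  have hs : ∀ i : Fin 5, ∑ p ∈ s, w i p • taylorCoeffAt x₀ y₀ p = ∑ p ∈ s, w' i p • taylorCoeffAt x₀ y₀ p :=
    fun i => Finset.sum_congr rfl (fun p hp => by rw [h i p hp])
  simp only [taylorCrossing, hs 0, hs 1, hs 2, hs 3, hs 4]

namespace TaylorTable

variable (T : TaylorTable)

/-- Box inclusion in real coordinates from the four rational endpoint inequalities. [folklore] -/
theorem mem_box_superset {σlo' σhi' εlo' εhi' : ℚ} (hσlo : σlo' ≤ T.σlo) (hσhi : T.σhi ≤ σhi')
    (hεlo : εlo' ≤ T.εlo) (hεhi : T.εhi ≤ εhi') {p : ℝ × ℝ} (hp : p ∈ T.box) :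
    p ∈ Icc (σlo' : ℝ) σhi' ×ˢ Icc (εlo' : ℝ) εhi' := by
  simp only [TaylorTable.box, Set.mem_prod, Set.mem_Icc] at hp ⊢
  have h1 : ((σlo' : ℚ) : ℝ) ≤ (T.σlo : ℝ) := by exact_mod_cast hσlo
  have h2 : ((T.σhi : ℚ) : ℝ) ≤ (σhi' : ℝ) := by exact_mod_cast hσhi
  have h3 : ((εlo' : ℚ) : ℝ) ≤ (T.εlo : ℝ) := by exact_mod_cast hεlo
  have h4 : ((T.εhi : ℚ) : ℝ) ≤ (εhi' : ℝ) := by exact_mod_cast hεhi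
  exact ⟨⟨h1.trans hp.1.1, hp.1.2.trans h2⟩, ⟨h3.trans hp.2.1, hp.2.2.trans h4⟩⟩

/-- The table's functional equals the Taylor crossing functional of any weight function agreeing with `T.c` on `T.L`. [folklore] -/
theorem α_eq_of_agree {l' : List (ℕ × ℕ)} {c' : Fin 5 → ℕ × ℕ → ℚ} (hl : l' = T.L)
    (hc : ∀ i : Fin 5, ∀ ab ∈ T.L, c' i ab = T.c i ab) :
    (taylorCrossing (1 / 2) (1 / 2) l'.toFinset fun i ab => (c' i ab : ℝ)) = T.α := by
  rw [TaylorTable.α, hl]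
  exact taylorCrossing_congr _ _ _ (fun i p hp => by rw [hc i p (List.mem_toFinset.mp hp)])

/-- The table's majorant equals the Taylor majorant of any weight function agreeing with `T.ψ` on `T.Lψ`. [folklore] -/
theorem Ψ_eq_of_agree {lψ' : List (ℕ × ℕ)} {ψ' : ℕ × ℕ → ℚ} (hlψ : lψ' = T.Lψ) (hψ : ∀ ab ∈ T.Lψ, ψ' ab = T.ψ ab) :
    (∑ ab ∈ lψ'.toFinset, (ψ' ab : ℝ) • taylorCoeffAt (1 / 2) (1 / 2) ab) = T.Ψ := by
  rw [TaylorTable.Ψ, hlψ]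
  exact Finset.sum_congr rfl (fun ab hab => by rw [hψ ab (List.mem_toFinset.mp hab)])

/-- **BRIDGE, even sector.** A `TaylorEvenRegion` statement for a record whose box contains the table's box,
whose index list is the table's, whose weights agree with the table's on the index list and whose threshold is
`T.E₀` gives the table's even-region hypothesis `hR` by name. [cite: KosPolandSimmonsduffin2014, §3.3 eq. (3.16)] -/
theorem evenRegion_of_superset {σlo' σhi' εlo' εhi' E0' : ℚ} {l' : List (ℕ × ℕ)} {c' : Fin 5 → ℕ × ℕ → ℚ}
    (hσlo : σlo' ≤ T.σlo) (hσhi : T.σhi ≤ σhi') (hεlo : εlo' ≤ T.εlo) (hεhi : T.εhi ≤ εhi')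
    (hl : l' = T.L) (hc : ∀ i : Fin 5, ∀ ab ∈ T.L, c' i ab = T.c i ab) (hE : E0' = T.E₀)
    (h : TaylorEvenRegion (taylorCrossing (1 / 2) (1 / 2) l'.toFinset fun i ab => (c' i ab : ℝ))
      (Icc (σlo' : ℝ) σhi' ×ˢ Icc (εlo' : ℝ) εhi') ((E0' : ℚ) : ℝ)) :
    TaylorEvenRegion T.α T.box ((T.E₀ : ℚ) : ℝ) := by
  intro p hp E j hE' hj
  rw [← T.α_eq_of_agree hl hc]
  exact h p (T.mem_box_superset hσlo hσhi hεlo hεhi hp) E j (by rw [hE]; exact hE') hj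

/-- **BRIDGE, odd sector.** An odd-cone statement (the conclusion shape of `oddCone_of_splitΔLPS`) for a record
whose box contains the table's box, with the table's index lists, weights agreeing on `T.L`, majorant weights
agreeing on `T.Lψ`, `κ₀' = T.κ₀` and threshold `T.E_T` gives the table's odd-cone hypothesis `hC` by name.
[cite: KosPolandSimmonsduffin2014, §3.3 eq. (3.16)] -/
theorem oddCone_of_superset {σlo' σhi' εlo' εhi' κ₀' E0' : ℚ} {l' lψ' : List (ℕ × ℕ)}
    {c' : Fin 5 → ℕ × ℕ → ℚ} {ψ' : ℕ × ℕ → ℚ}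
    (hσlo : σlo' ≤ T.σlo) (hσhi : T.σhi ≤ σhi') (hεlo : εlo' ≤ T.εlo) (hεhi : T.εhi ≤ εhi')
    (hl : l' = T.L) (hlψ : lψ' = T.Lψ) (hc : ∀ i : Fin 5, ∀ ab ∈ T.L, c' i ab = T.c i ab)
    (hψ : ∀ ab ∈ T.Lψ, ψ' ab = T.ψ ab) (hκ : κ₀' = T.κ₀) (hE : E0' = T.E_T)
    (h : ∀ p ∈ Icc (σlo' : ℝ) σhi' ×ˢ Icc (εlo' : ℝ) εhi', ∀ (E : ℝ) (j : ℕ), ((E0' : ℚ) : ℝ) ≤ E → (j : ℝ) ≤ E →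
      OddConeAt (taylorCrossing (1 / 2) (1 / 2) l'.toFinset fun i ab => (c' i ab : ℝ))
        (∑ ab ∈ lψ'.toFinset, (ψ' ab : ℝ) • taylorCoeffAt (1 / 2) (1 / 2) ab) (κ₀' : ℝ) p.1 p.2 E j) :
    T.OddCone := by
  intro p hp E j hE' hj
  have h' := h p (T.mem_box_superset hσlo hσhi hεlo hεhi hp) E j (by rw [hE]; exact hE') hj
  rw [T.α_eq_of_agree hl hc, T.Ψ_eq_of_agree hlψ hψ, hκ] at h'
  exact h'

end TaylorTable

/-! ### Smoke test (kernel): an if-chain weight function agrees with a list-lookup weight function on an index list although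
the two functions are defined differently — the shape of the bridge hypothesis `hc`, `decide`d. -/

example : ∀ i : Fin 5, ∀ ab ∈ [(1, 0), (2, 1), (3, 0)],
    (fun (i : Fin 5) (ab : ℕ × ℕ) => (if i = 0 then (if ab = (1, 0) then (3 : ℚ) else 0)
      else if i = 1 then (if ab = (2, 1) then -5 / 2 else 0) else 0)) i ab =
    (fun (k : Fin 5) (ab : ℕ × ℕ) =>
      (([((0 : ℕ), ((1 : ℕ), (0 : ℕ)), (3 : ℚ)), (1, (2, 1), -5 / 2)].filter fun e => e.1 = k.val ∧ e.2.1 = ab).headD (0, (0, 0), 0)).2.2) i ab := by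
  decide +kernel

/-! ### Component-wise versions (boot-1 g11, second part)

The region file sets carry only the components their sector uses: the EVEN record zeroes component `2` (α₃) and the
ODD record zeroes components `0, 1` (α₁, α₂). `TaylorEvenRegion` reads `α₁, α₂, α₄, α₅` only and `OddConeAt` reads
`α₃, α₄, α₅` only, so agreement on THOSE components (on the index list) suffices. -/

section Components
variable (x₀ y₀ : ℝ) (s : Finset (ℕ × ℕ)) {w w' : Fin 5 → ℕ × ℕ → ℝ}

/-- `α₁` of the Taylor crossing functional depends on `w 0` on `s` only. [folklore] -/
theorem taylorCrossing_α₁_congr (h : ∀ p ∈ s, w 0 p = w' 0 p) :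
    (taylorCrossing x₀ y₀ s w).α₁ = (taylorCrossing x₀ y₀ s w').α₁ := by
  simp only [taylorCrossing]; exact Finset.sum_congr rfl (fun p hp => by rw [h p hp])

/-- `α₂` depends on `w 1` on `s` only. [folklore] -/
theorem taylorCrossing_α₂_congr (h : ∀ p ∈ s, w 1 p = w' 1 p) :
    (taylorCrossing x₀ y₀ s w).α₂ = (taylorCrossing x₀ y₀ s w').α₂ := by
  simp only [taylorCrossing]; exact Finset.sum_congr rfl (fun p hp => by rw [h p hp])

/-- `α₃` depends on `w 2` on `s` only. [folklore] -/
theorem taylorCrossing_α₃_congr (h : ∀ p ∈ s, w 2 p = w' 2 p) :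
    (taylorCrossing x₀ y₀ s w).α₃ = (taylorCrossing x₀ y₀ s w').α₃ := by
  simp only [taylorCrossing]; exact Finset.sum_congr rfl (fun p hp => by rw [h p hp])

/-- `α₄` depends on `w 3` on `s` only. [folklore] -/
theorem taylorCrossing_α₄_congr (h : ∀ p ∈ s, w 3 p = w' 3 p) :
    (taylorCrossing x₀ y₀ s w).α₄ = (taylorCrossing x₀ y₀ s w').α₄ := by
  simp only [taylorCrossing]; exact Finset.sum_congr rfl (fun p hp => by rw [h p hp])

/-- `α₅` depends on `w 4` on `s` only. [folklore] -/
theorem taylorCrossing_α₅_congr (h : ∀ p ∈ s, w 4 p = w' 4 p) :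
    (taylorCrossing x₀ y₀ s w).α₅ = (taylorCrossing x₀ y₀ s w').α₅ := by
  simp only [taylorCrossing]; exact Finset.sum_congr rfl (fun p hp => by rw [h p hp])

/-- **`TaylorEvenRegion` only reads components 0, 1, 3, 4 of the weights (on the index set).** [folklore] -/
theorem taylorEvenRegion_congr_weights (h0 : ∀ p ∈ s, w 0 p = w' 0 p) (h1 : ∀ p ∈ s, w 1 p = w' 1 p)
    (h3 : ∀ p ∈ s, w 3 p = w' 3 p) (h4 : ∀ p ∈ s, w 4 p = w' 4 p) {Q : Set (ℝ × ℝ)} {E₀ : ℝ}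
    (h : TaylorEvenRegion (taylorCrossing x₀ y₀ s w) Q E₀) : TaylorEvenRegion (taylorCrossing x₀ y₀ s w') Q E₀ := by
  intro p hp E j hE hj
  rw [← taylorCrossing_α₁_congr x₀ y₀ s h0, ← taylorCrossing_α₂_congr x₀ y₀ s h1,
    ← taylorCrossing_α₄_congr x₀ y₀ s h3, ← taylorCrossing_α₅_congr x₀ y₀ s h4]
  exact h p hp E j hE hj

/-- **`OddConeAt` only reads components 2, 3, 4 of the weights (on the index set).** [folklore] -/
theorem oddConeAt_congr_weights (h2 : ∀ p ∈ s, w 2 p = w' 2 p) (h3 : ∀ p ∈ s, w 3 p = w' 3 p)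
    (h4 : ∀ p ∈ s, w 4 p = w' 4 p) {Ψ : (ℝ → ℝ → ℝ) →ₗ[ℝ] ℝ} {κ₀ Δσ Δε E : ℝ} {j : ℕ}
    (h : OddConeAt (taylorCrossing x₀ y₀ s w) Ψ κ₀ Δσ Δε E j) : OddConeAt (taylorCrossing x₀ y₀ s w') Ψ κ₀ Δσ Δε E j := by
  unfold OddConeAt at h ⊢
  rw [← taylorCrossing_α₃_congr x₀ y₀ s h2, ← taylorCrossing_α₄_congr x₀ y₀ s h3, ← taylorCrossing_α₅_congr x₀ y₀ s h4]
  exact h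

end Components

namespace TaylorTable

variable (T : TaylorTable)

/-- **BRIDGE, even sector, sector components only.** As `evenRegion_of_superset`, but the weights need agree with the
table's only in components `0, 1, 3, 4` on `T.L` (one decidable conjunction per index) — the even region record carries
no `α₃`. [cite: KosPolandSimmonsduffin2014, §3.3 eq. (3.16)] -/
theorem evenRegion_of_superset' {σlo' σhi' εlo' εhi' E0' : ℚ} {l' : List (ℕ × ℕ)} {c' : Fin 5 → ℕ × ℕ → ℚ}
    (hσlo : σlo' ≤ T.σlo) (hσhi : T.σhi ≤ σhi') (hεlo : εlo' ≤ T.εlo) (hεhi : T.εhi ≤ εhi')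
    (hl : l' = T.L)
    (hc : ∀ ab ∈ T.L, c' 0 ab = T.c 0 ab ∧ c' 1 ab = T.c 1 ab ∧ c' 3 ab = T.c 3 ab ∧ c' 4 ab = T.c 4 ab)
    (hE : E0' = T.E₀)
    (h : TaylorEvenRegion (taylorCrossing (1 / 2) (1 / 2) l'.toFinset fun i ab => (c' i ab : ℝ))
      (Icc (σlo' : ℝ) σhi' ×ˢ Icc (εlo' : ℝ) εhi') ((E0' : ℚ) : ℝ)) :
    TaylorEvenRegion T.α T.box ((T.E₀ : ℚ) : ℝ) := by
  subst hl
  have h' : TaylorEvenRegion T.α (Icc (σlo' : ℝ) σhi' ×ˢ Icc (εlo' : ℝ) εhi') ((E0' : ℚ) : ℝ) := by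
    rw [TaylorTable.α]
    refine taylorEvenRegion_congr_weights (1 / 2) (1 / 2) T.L.toFinset ?_ ?_ ?_ ?_ h
    · intro p hp; have := (hc p (List.mem_toFinset.mp hp)).1; simp only [this]
    · intro p hp; have := (hc p (List.mem_toFinset.mp hp)).2.1; simp only [this]
    · intro p hp; have := (hc p (List.mem_toFinset.mp hp)).2.2.1; simp only [this]
    · intro p hp; have := (hc p (List.mem_toFinset.mp hp)).2.2.2; simp only [this]
  intro p hp E j hE' hj
  exact h' p (T.mem_box_superset hσlo hσhi hεlo hεhi hp) E j (by rw [hE]; exact hE') hj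

/-- **BRIDGE, odd sector, sector components only.** As `oddCone_of_superset`, but the weights need agree with the table's
only in components `2, 3, 4` on `T.L` — the odd cone record carries no `α₁, α₂`. [cite: KosPolandSimmonsduffin2014, §3.3 eq. (3.16)] -/
theorem oddCone_of_superset' {σlo' σhi' εlo' εhi' κ₀' E0' : ℚ} {l' lψ' : List (ℕ × ℕ)}
    {c' : Fin 5 → ℕ × ℕ → ℚ} {ψ' : ℕ × ℕ → ℚ}
    (hσlo : σlo' ≤ T.σlo) (hσhi : T.σhi ≤ σhi') (hεlo : εlo' ≤ T.εlo) (hεhi : T.εhi ≤ εhi')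
    (hl : l' = T.L) (hlψ : lψ' = T.Lψ)
    (hc : ∀ ab ∈ T.L, c' 2 ab = T.c 2 ab ∧ c' 3 ab = T.c 3 ab ∧ c' 4 ab = T.c 4 ab)
    (hψ : ∀ ab ∈ T.Lψ, ψ' ab = T.ψ ab) (hκ : κ₀' = T.κ₀) (hE : E0' = T.E_T)
    (h : ∀ p ∈ Icc (σlo' : ℝ) σhi' ×ˢ Icc (εlo' : ℝ) εhi', ∀ (E : ℝ) (j : ℕ), ((E0' : ℚ) : ℝ) ≤ E → (j : ℝ) ≤ E →
      OddConeAt (taylorCrossing (1 / 2) (1 / 2) l'.toFinset fun i ab => (c' i ab : ℝ))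
        (∑ ab ∈ lψ'.toFinset, (ψ' ab : ℝ) • taylorCoeffAt (1 / 2) (1 / 2) ab) (κ₀' : ℝ) p.1 p.2 E j) :
    T.OddCone := by
  subst hl
  intro p hp E j hE' hj
  have h1 := h p (T.mem_box_superset hσlo hσhi hεlo hεhi hp) E j (by rw [hE]; exact hE') hj
  rw [T.Ψ_eq_of_agree hlψ hψ, hκ] at h1
  rw [TaylorTable.α]
  refine oddConeAt_congr_weights (1 / 2) (1 / 2) T.L.toFinset ?_ ?_ ?_ h1
  · intro q hq; have := (hc q (List.mem_toFinset.mp hq)).1; simp only [this]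
  · intro q hq; have := (hc q (List.mem_toFinset.mp hq)).2.1; simp only [this]
  · intro q hq; have := (hc q (List.mem_toFinset.mp hq)).2.2; simp only [this]

end TaylorTable

end Summit.CriticalPhenomena.Ising3D
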